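import Literature.NumberTheory.EllipticCurves.Kato2004.UniversalNormsCoeffFramed
import Literature.NumberTheory.EllipticCurves.Kato2004.IwasawaCohomologyCoeff
import Literature.NumberTheory.EllipticCurves.PadicCoeffIntegersFrobeniusData
import Literature.NumberTheory.EllipticCurves.NewformsCoeffFieldHolds
import HarnessLib

/-!
# Kato 2004 (Astérisque 295) Lemma 8.5 (2) with general coefficients — the predicate
# `UniversalNormsIntegral T p κ` ("cores-compatible families along `κ` are integral"), its currency
# lemmas for Kato's `𝐇¹ = lim← H¹(ℤ_n[1/p], T)`, and the cases proved in the tree (`T_pW`, `T_ρ`)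

Topic `NumberTheory/EllipticCurves`, sub-directory `Kato2004` (namespace = path).  ONE DEFINITION (a
PREDICATE with parameters `T p κ`, nothing asserted; D-0014) and theorems; no instance, no notation, no
named fact, no `sorry`.  Written by a prover seat of the cell `bsd-wall` (route
`ResidualThetaTransportAtTwo`, crux RSL_g stmt-BirchSwinnertonDyer-22608) as item UN_ρ of the stub plan
`Cruxes/ResidualThetaCountLowerPureAtTwo/STUB-PLAN-stub_cmLambdaLower.md` (rev 12) = card
`stub-cmlambdalower-k3-g9` PLAN 1: the predicate is that card's H1 VERBATIM (same binders, same body),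
so that the card's kernel-checked glue `deepHalf_of_flat : UniversalNormsIntegral T p κ → … →
DeepHalfFlat … → DeepHalf …` (S4rel ⟸ S4rel♭ + UN) applies to it by name.

* `UniversalNormsIntegral T p κ` — for a continuous representation `T` of `Gal(ℚ̄/ℚ)` with
  coefficients `A` and the `ℤ_p`-extension `κ`: IF `κ` is the cyclotomic one, every family
  `z_n ∈ H¹(ℚ_n, T)` with `Cor z_{n+1} = z_n` consists of INTEGRAL classes
  (`z_n ∈ Kato2004.integralH1 T p (κ.layerSubgroup n)`, unramified at every `v ≠ p`).  This is the
  general-coefficient form of Kato's Lemma 8.5 (2) ("the image of `lim←ₙ H¹(K(ζ_{pⁿ}), T) → H¹(K, T)` is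
  contained in the image of `H¹(O_K[1/p], T)`", p. 183; = Rubin B.3.3 = Perrin-Riou 2.2.4), i.e. the
  `TODO(general form)` of the tree's named fact `Kato2004.mem_integralH1_of_forall_layerCores_eq`
  (stated there for `T = T_pW` only and proved in `UniversalNormsIntegralProofs`).
* Currency lemmas for the pinned interface `I : Kato2004.IwasawaH1DataCoeff T p κ γ` under the predicate:
  `UniversalNormsIntegral.isNormCompatible_iff` (the `integralH1` clause of `IsNormCompatible` is
  redundant), `UniversalNormsIntegral.existsUnique_proj_eq` (every cores-compatible family is the
  projection family of a UNIQUE element of `𝐇¹`), `UniversalNormsIntegral.range_toFamily_eq`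
  (`𝐇¹ ≅ {cores-compatible families}` = `lim←ₙ H¹(ℚ_n, T)`, full cohomology).
* The predicate HOLDS in the two coefficient systems of the tree:
  `universalNormsIntegral_tateRep` (`T = T_pW`, the K6 theorem `UniversalNorms.mem_integralH1_of_layerCores_eq`);
  `universalNormsIntegral_framed` / `…_of_finiteDimensional` (`T = T_ρ = 𝒪ⁿ` for a framed
  `ρ : Γ_ℚ → GL_n(𝒪)`, `𝒪 = padicCoeffIntegers S` compact, e.g. `ℚ_p(S)/ℚ_p` finite:
  `UniversalNorms.mem_integralH1_of_layerCores_eq_framed`); `universalNormsIntegral_newform` — the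
  NEWFORM currency of the crux (`ρ : FramedGaloisRep ℚ (padicCoeffIntegers (Set.range ι)) 2` for a
  newform `g ∈ S₂(Γ₀(M))` and `ι : K_g → ℚ̄_p`, every `p` including `p = 2`; `K_g` is a number field, so
  `ℚ_p(ι K_g)/ℚ_p` is finite).

HONEST FRAMING: the predicate is a statement form, not an assertion; the instances are ports of a
published, tree-proved lemma; nothing here is specific to BSD; BSD is not proved by any of this.

References: K. Kato, Astérisque 295 (2004), §8.2, Lemma 8.5 (pp. 180–184), §12.2 (p. 220)
[Kato2004Asterisque]; K. Rubin, *Euler Systems* (2000), App. B Prop. B.3.3 [Rubin2000]; B. Perrin-Riou,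
Astérisque 229 (1995), 2.2.4 [PerrinRiou1995Asterisque].
-/

noncomputable section

open scoped NumberField
open Field IsDedekindDomain CongruenceSubgroup
open Literature.NumberTheory.GaloisRepresentations
open Literature.NumberTheory.EllipticCurves Literature.NumberTheory.EllipticCurves.ModularForms
open Literature.NumberTheory.EllipticCurves.ZpExtension
open Literature.NumberTheory.EllipticCurves.Kato2004
open Literature.NumberTheory.EllipticCurves.Kato2004.EulerSystemValues

namespace Literature.NumberTheory.EllipticCurves.Kato2004

/-! ## The predicate -/

section Predicate

variable {A : Type} [CommRing A] [TopologicalSpace A] {M : Type} [AddCommGroup M] [Module A M]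
  [TopologicalSpace M] [IsTopologicalAddGroup M] [ContinuousSMul A M]

/-- **Kato 2004, Lemma 8.5 (2), general-coefficient form, as a PREDICATE on `(T, p, κ)`.**  For a
continuous representation `T` of `Gal(ℚ̄/ℚ)` with coefficients `A` and a `ℤ_p`-extension `κ` of `ℚ`:
if `κ` is the cyclotomic `ℤ_p`-extension, then every CORES-COMPATIBLE family `z_n ∈ H¹(ℚ_n, T)` along
its layers (`Cor z_{n+1} = z_n`, `Kato2004.layerCores`) consists of integral classes
(`z_n ∈ H¹(ℤ_n[1/p], T) = Kato2004.integralH1`, i.e. unramified at every `v ≠ p`).  Printed for every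
finitely generated `ℤ_p`-module `T`: "The image of `lim←_n H¹(K(ζ_{p^n}), T) → H¹(K, T)` is contained in
the image of `H¹(O_K[1/p], T) → H¹(K, T)`" [Kato, Lemma 8.5 (2), p. 183] (= [Rubin2000, B.3.3],
Perrin-Riou 2.2.4: universal norms).  Slack-free and purity-free.  It HOLDS for `T = T_pW`
(`universalNormsIntegral_tateRep`) and for the lattice of a framed representation over the integers of
a finite extension of `ℚ_p` (`universalNormsIntegral_framed_of_finiteDimensional`); stated as a predicate
so that consumers (the Poitou–Tate port of crux RSL_g) can take it as a hypothesis for other `T`.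
[cite: Kato2004Asterisque, Lemma 8.5 (2) (p. 183)] [cite: Rubin2000, App. B Prop. B.3.3] -/
def UniversalNormsIntegral (T : GaloisRep ℚ A M) (p : ℕ) [Fact p.Prime] (κ : ZpExtension ℚ p) : Prop :=
  κ.IsCyclotomic → ∀ z : (∀ n : ℕ, H1 T (κ.layerSubgroup n)),
    (∀ n, layerCores T κ n (z (n + 1)) = z n) → ∀ n, z n ∈ integralH1 T p (κ.layerSubgroup n)

variable {T : GaloisRep ℚ A M} {p : ℕ} [Fact p.Prime] {κ : ZpExtension ℚ p}
  {γ : absoluteGaloisGroup ℚ}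

namespace UniversalNormsIntegral

/-- Under `UniversalNormsIntegral`, the integrality clause of `Kato2004.IsNormCompatible` is REDUNDANT:
a family along the cyclotomic tower is a norm-compatible integral family iff it is cores-compatible.
[cite: Kato2004Asterisque, Lemma 8.5 (2) (p. 183) and §12.2 (p. 220)] -/
theorem isNormCompatible_iff (h : UniversalNormsIntegral T p κ) (hκ : κ.IsCyclotomic)
    (y : ∀ n : ℕ, H1 T (κ.layerSubgroup n)) :
    IsNormCompatible T κ y ↔ ∀ n, layerCores T κ n (y (n + 1)) = y n :=
  ⟨fun hy => hy.2, fun hy => ⟨h hκ y hy, hy⟩⟩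

/-- **The `∃!`-transport.**  Under `UniversalNormsIntegral`, every cores-compatible family `y` along the
cyclotomic tower is the projection family of a UNIQUE element of Kato's `𝐇¹ = I.H`
(`IwasawaH1DataCoeff.proj_surjective` fed by the predicate, `proj_injective`).
[cite: Kato2004Asterisque, §12.2 (p. 220) with Lemma 8.5 (2) (p. 183)] -/
theorem existsUnique_proj_eq (I : IwasawaH1DataCoeff T p κ γ) (h : UniversalNormsIntegral T p κ)
    (hκ : κ.IsCyclotomic) (y : ∀ n : ℕ, H1 T (κ.layerSubgroup n))
    (hy : ∀ n, layerCores T κ n (y (n + 1)) = y n) : ∃! x : I.H, ∀ n, I.proj n x = y n := by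
  obtain ⟨x, hx⟩ := I.proj_surjective y ⟨h hκ y hy, hy⟩
  refine ⟨x, hx, fun x' hx' => ?_⟩
  have h0 : x' - x = 0 := I.proj_injective _ fun n => by rw [map_sub, hx n, hx' n, sub_self]
  exact sub_eq_zero.mp h0

/-- **`𝐇¹ = lim←_n H¹(ℚ_n, T)` (full cohomology).**  Under `UniversalNormsIntegral`, the family map
`x ↦ (proj n x)_n` is a bijection of `I.H` onto the CORES-COMPATIBLE families (its injectivity is
`IwasawaH1DataCoeff.eq_of_toFamily_eq`). [cite: Kato2004Asterisque, §12.2 (p. 220) with Lemma 8.5 (2) (p. 183)] -/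
theorem range_toFamily_eq (I : IwasawaH1DataCoeff T p κ γ) (h : UniversalNormsIntegral T p κ)
    (hκ : κ.IsCyclotomic) :
    Set.range I.toFamily = {y | ∀ n, layerCores T κ n (y (n + 1)) = y n} := by
  ext y
  constructor
  · rintro ⟨x, rfl⟩ n
    exact I.cores_proj n x
  · intro hy
    obtain ⟨x, hx, -⟩ := existsUnique_proj_eq I h hκ y hy
    exact ⟨x, funext hx⟩

end UniversalNormsIntegral

end Predicate

/-! ## The cases proved in the tree -/

section Instances

/-- **`UniversalNormsIntegral (T_pW) p κ` holds** for every elliptic curve `W/ℚ` and every prime `p` —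
the K6 theorem `UniversalNorms.mem_integralH1_of_layerCores_eq` (Kato's Lemma 8.5 (2) for `T = T_pW`)
by name. [cite: Kato2004Asterisque, Lemma 8.5 (2) (p. 183)] [cite: Rubin2000, App. B Prop. B.3.3] -/
theorem universalNormsIntegral_tateRep (W : WeierstrassCurve ℚ) [W.IsElliptic] (p : ℕ) [Fact p.Prime]
    [ContinuousSMul ℤ_[p] (W.tateModule p)] (κ : ZpExtension ℚ p) :
    UniversalNormsIntegral (tateRep W p) p κ :=
  fun hκ z hz n => UniversalNorms.mem_integralH1_of_layerCores_eq W p κ hκ z hz n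

variable {p : ℕ} [Fact p.Prime] (S : Set (PadicAlgCl p)) {n : ℕ}

/-- **`UniversalNormsIntegral (T_ρ) p κ` holds** for the lattice `T_ρ = 𝒪ⁿ` of a framed representation
`ρ : Gal(ℚ̄/ℚ) → GL_n(𝒪)` with `𝒪 = padicCoeffIntegers S` COMPACT
(`UniversalNorms.mem_integralH1_of_layerCores_eq_framed`). [cite: Kato2004Asterisque, Lemma 8.5 (2) (p. 183)]
[cite: Rubin2000, App. B Prop. B.3.3] -/
theorem universalNormsIntegral_framed [CompactSpace (padicCoeffIntegers S)]
    (ρ : FramedGaloisRep ℚ (padicCoeffIntegers S) n) (κ : ZpExtension ℚ p) :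
    UniversalNormsIntegral (FramedGaloisRep.toGaloisRep ρ) p κ :=
  fun hκ z hz m => UniversalNorms.mem_integralH1_of_layerCores_eq_framed S ρ κ hκ z hz m

/-- **`UniversalNormsIntegral (T_ρ) p κ` holds** for `𝒪 = padicCoeffIntegers S` the valuation ring of a
FINITE extension `ℚ_p(S)` of `ℚ_p` (`UniversalNorms.compactSpace_padicCoeffIntegers`).
[cite: Kato2004Asterisque, Lemma 8.5 (2) (p. 183)] [cite: Rubin2000, App. B Prop. B.3.3] -/
theorem universalNormsIntegral_framed_of_finiteDimensional [FiniteDimensional ℚ_[p] (padicCoeffField S)]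
    (ρ : FramedGaloisRep ℚ (padicCoeffIntegers S) n) (κ : ZpExtension ℚ p) :
    UniversalNormsIntegral (FramedGaloisRep.toGaloisRep ρ) p κ :=
  fun hκ z hz m => UniversalNorms.mem_integralH1_of_layerCores_eq_framed_of_finiteDimensional S ρ κ hκ z hz m

/-- **Newform currency (the crux's `K0` binders): `UniversalNormsIntegral (T_ρ) p κ` holds for every
integral `p`-adic lattice `ρ : Γ_ℚ → GL₂(𝒪)`, `𝒪 = padicCoeffIntegers (Set.range ι)`, attached to a
NEWFORM `g ∈ S₂(Γ₀(M))` and an embedding `ι : K_g → ℚ̄_p`** — every prime `p` (including `p = 2`), no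
hypothesis on `ρ` beyond its coefficient ring: `K_g` is a number field (Shimura 3.48,
`IsNewform0.finiteDimensional_coeffField_holds`), so `ℚ_p(ι K_g)/ℚ_p` is finite
(`GreenbergSelmer.finiteDimensional_padicCoeffField`) and `𝒪` is compact.  This is the `UN_ρ` input of the
Poitou–Tate port of crux RSL_g (stub plan rev 12 / card k3-g9): Kato's Lemma 8.5 (2) for `T_ρ`.
[cite: Kato2004Asterisque, Lemma 8.5 (2) (p. 183)] [cite: Rubin2000, App. B Prop. B.3.3]
[cite: Shimura1971, Thm. 3.48] -/
theorem universalNormsIntegral_newform (p : ℕ) [Fact p.Prime] (M : ℕ) [NeZero M] (g : CuspForm (Gamma0 M) 2)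
    (ι : coeffField g →+* PadicAlgCl p) (ρ : FramedGaloisRep ℚ (padicCoeffIntegers (Set.range ι)) 2)
    (κ : ZpExtension ℚ p) (hg : IsNewform0 g) :
    UniversalNormsIntegral (FramedGaloisRep.toGaloisRep ρ) p κ := by
  haveI : FiniteDimensional ℚ (coeffField g) := IsNewform0.finiteDimensional_coeffField_holds hg
  haveI : FiniteDimensional ℚ_[p] (padicCoeffField (Set.range ι)) :=
    GreenbergSelmer.finiteDimensional_padicCoeffField ι
  exact universalNormsIntegral_framed_of_finiteDimensional (Set.range ι) ρ κ

end Instances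

end Literature.NumberTheory.EllipticCurves.Kato2004

end
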